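import Summits.BirchSwinnertonDyer.Rank1Residual.O6.KatoLocalFloor
import Literature.NumberTheory.EllipticCurves.IwasawaSelmer
import Literature.NumberTheory.EllipticCurves.Selmer
import Literature.NumberTheory.EllipticCurves.Tamagawa
import HarnessLib

/-!
# BSD rank-≤1 residual cell, class O6 (WILD `p = 3`), Iwasawa side: TARGET T-O6-G15 "Kurihara–Pollack at a wild 3" —
# the hypotheses (H1)–(H3) BY NAME, the VERBATIM-EXTENSION statement KP-3 (`X_∞` is `Λ`-free of rank one) as an
# EVIDENCE-labelled THEOREM-CANDIDATE node over the tree's `SelmerDualData`, the finite-level Kurihara–Pollack sequence as a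
# hypothesis SCHEMA over `selmerLayer`, and the LOCAL CRUX (L) = R-O6-LOC as an INTERFACE `LocalPointsModuleDatum` carrying the
# C-O6-MW module invariants (table of record with PROVED consistency checks) — TYPED, NOTHING ASSERTED beyond the one node

HONEST FRAMING (cell `b2b-bsdres`, run/shared/lean/b2b/bsd-rank1-residual/, verbatim in every file): the goal of
the cell is to DELETE the COMBINATION-SHAPED residual classes of the Birch–Swinnerton-Dyer formula for ALL
analytic-rank `≤ 1` elliptic curves over `ℚ` — assembled STRICTLY from published theorems — so that the rank-`≤ 1`
remainder becomes exactly the CONSTRUCTION-SHAPED classes, which are TYPED (missing-input `Prop`s), NOT attempted.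
This is not "finishing BSD". Lane CLASS-CLOSURE (`CLASS-CLOSURE-PLAN.md` §3.4 O6, deliverables (b) SUB-PARTITION —
the verbatim-extension part handed to PROVERS with its 'extends near-verbatim' statement — and the IRREDUCIBLE RESIDUE
named precisely for ideation): research routes; no claim beyond the stated classes; census / instrument output is
EVIDENCE, never a Literature fact; Kato's main conjecture KMC₃ enters ONLY as the slot-1 interface hypothesis of
`O6/O6Targets.lean`, never as a fact; nothing is booked; no mark of `RESIDUAL-MAP.md` moves; O6 stays OPEN. Closed
unproved `def : Prop` nodes carry `@[conjecture]` whatever the docstring grade (cc-lead ⟦gen22⟧ (8)(b)). 0 Literature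
facts are minted here.

## What is typed (cc-typer-5 GEN 11 = O5/O6 typer of record; ask (iii) of o6-r1 GEN 15, `HOME/INBOX.md` 2026-08-22T00:10Z /
## 00:31Z and `cells/o5o6/TARGETS.md` §O6 (G15-4)–(G15-6): "T-O6-G15 (KP-3 exact sequence + (L) as an interface
## `LocalPointsStructureThree` with the C-O6-MW invariants as its data, nothing asserted)"; content = o6-r1's memo of
## record `HOME/b2b-bsdres-o6-r1/gen15/O6-GEN15.md` §4.1–§4.5 (incl. the 00:30Z table §4.3b and the H-IDEAL verdict
## §4.5(d)); instrument C-O6-MW v1/v1.1 `gen15/mw/c_o6_mw.py` (kit j143027 smoke, j143088, j143437, j143439, j143548 ✓,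
## j143554); placement / names / interface shape / dedup = class typer)

SETTING (memo §4.1). `W ∈ O6`, `T = T₃W`, `k_n = ℚ(ζ_{3^{n+1}})⁺` = the `n`-th layer of the cyclotomic `ℤ₃`-extension of
`ℚ`, `G_n = Gal(k_n/ℚ)` cyclic of order `3^n`, `Λ_n = ℤ₃[G_n]`, `Λ = ℤ₃⟦Γ⟧`, `𝔭` the prime of `k_n` over `3`,
`M_n := W(k_{n,𝔭}) ⊗ ℤ₃`, `X_∞ := Sel_{3^∞}(W/ℚ_∞)^∨` (the tree's `SelmerDualData W κ γ`, `κ` cyclotomic).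

* §1 THE HYPOTHESES BY NAME (sub-partition predicate, tree vocabulary only): `KPHypothesesThree W` := (H1) `Sel₃(W/ℚ) = 0`
  (`Nat.card (W.selmerGroup 3) = 1`, Literature `Selmer.lean`) ∧ (H2) `3 ∤ c_ℓ(W)` for every prime `ℓ ≠ 3`
  (`(W.baseChange ℚ_[ℓ]).localTamagawaNumber ℤ_[ℓ]`, Literature `Tamagawa.lean`) and `W(ℚ)[3] = 0` ∧ (H3) `W(ℚ₃)[3] = 0`
  (hence `W(k_{n,𝔭})[3] = 0` for all `n`, `G_n` being a 3-group) — Pollack's "`E(ℚ)` finite, `p ∤ Tam(E/ℚ)`, `Ш(E/ℚ)[p] = 0`"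
  converted to the wild setting as o6-r1 prints them (potential supersingularity replaces "good supersingular"; (H3)
  replaces "`a_p ≢ 1 (mod p)`").
* §2 KP-3 `KuriharaPollackFreeRankOneThree` (`@[conjecture]`, THEOREM-CANDIDATE = the 'extends near-verbatim' statement for
  PROVERS): under O6 + (H1)–(H3), `X_∞` is a FREE `Λ`-module of RANK ONE. Printed template: Pollack 2005 Prop. 2.3 (good
  supersingular: Schneider's `rank_Λ X_∞ ≥ 1` + `Ê(ℚ_p) ↠ (X_∞)_Γ` from `Sel_p(E/ℚ) = 0` + compact Nakayama), with Thm. 2.1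
  (control for the `p`-relaxed Selmer group `Sel′`, Mazur / Greenberg LNM 1716, "the ordinary hypothesis is only used at the
  primes over `p`") and Prop. 2.2 (`H¹(ℚ_{∞,p}, E)[p^∞] = 0`, Hazewinkel) — in the tree the latter is KP-1 =
  Coates–Greenberg for the deeply ramified `k_{∞,𝔭}` (`CoatesGreenberg1996_H1_formalGroup_trivial`; n1011-p05's A1/A2
  `Additive/MinimalModelKernelH1OfDeeplyRamified.lean`, `Additive/PotSupersingularNotCotorsionOfDeeplyRamified.lean` give the
  minimal-model / not-cotorsion currency on O5; the O6 analogue of Schneider's bound is part of what the prover transports).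
* §3 THE FINITE-LEVEL SEQUENCE (KP-3(n), Pollack (3) p. 5: `M_n —F_n→ Λ_n → Sel_p(E/ℚ_n)^∨ → 0`) as a hypothesis SCHEMA
  `KuriharaPollackSequenceShape` over the tree's `W.selmerLayer κ n`: `#Sel_{3^∞}(W/k_n) = 3^{i_n}` with `i_n` the length of
  `Λ_n/F_n(M_n)` — an abstract index function; under KMC₃ (KP-4, slot-1 interface only) `i_n = ord₃[Λ_n² : M_n + Λ_n z_n]`,
  a MODULE INDEX of the `L`-value vector in a local lattice (memo §4.1). Nothing asserted.
* §4 THE LOCAL CRUX (L) = R-O6-LOC as an INTERFACE `LocalPointsModuleDatum W` (definition request D-O6-MW): per level `n`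
  the `ℤ₃[G_n]`-module invariants of `M := log_{ω_ℚ} Ê_min(𝔪_{k_n,𝔭})` that C-O6-MW measures — `gens n = g_n` (minimal
  number of `Λ_n`-generators), `jordan n` (Jordan type of `σ − 1` on `M/3M`, a partition of `3^n`), `h1 n` (elementary
  divisors of `H¹(G_n, Ê_min(𝔪))` = torsion of the coinvariants, memo §4.5(b)), `atop n`, `jmin n`, `jcum n`, `ostab n`
  (`ord₃[M + πM : M]`, `0` iff `M` is literally an ideal); the structural identities every realised datum satisfies
  (`IsConsistent`: `Σ jordan = 3^n`, `#blocks = g_n = 1 + #(cyclic factors of H¹)` — linear algebra of a cyclic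
  `G_n`-lattice of `ℚ₃[G_n]`-rank one, memo §4.5(b)) as a predicate, PROVED on every row of the table of record; the
  C-O6-MW TABLE of memo §4.3b (`mwTable`, 33 level-rows incl. the calibration rows 11a1 / 17a1 / 32a1) as census EVIDENCE
  with `decide`d consistency; and NO law: o6-r1's readings (R1) "constant within (τ, class)", (R2) "separates IRR from
  reducible at fixed τ, blind to `j = 0`", the H-IDEAL verdict ("`M_n ≅ 𝔪^j`": TRUE literally at `n = 2` for (3,II) IRR,
  FALSE at `n = 3` for every class) are recorded in the docstrings as EVIDENCE, not typed as nodes (memo §5: "(L): OPEN —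
  this is the residue handed to ideation"; a structure THEOREM for `M_n` is CONSTRUCTION-shaped and not attempted).

RESIDUE NAMED (memo §4.4, for ideation; docstring record only): R-O6-AN (a 3-adic analytic object for `d ∈ {3,6,12}` at
`p = 3`; Delbourgo 1998 Hyp. (G) needs `d ∣ 2` and holds for NO O6 curve, his p. 30 poses exactly this case) and R-O6-LOC
(= (L): the `Λ_n`-structure theorem of `M_n` per `(τ, W[3]|G_{ℚ₃})` — the Kobayashi Thm. 3.1 analogue for the wild
potentially supersingular formal group; nearest formalism Bondarko's associated Galois modules; presearch by o6-r1: corpus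
Childs 2000 pp. 175–177 → Taylor / Byott (Lubin–Tate, height one only), Lettl 1998 Thm 1, Byott 1997 Thm 3.10/3.13
(ideals — ruled out from `n = 3` by H-IDEAL), galaxy pdf needles "formal group|Galois module structure|norm-coherent"
no relevant hit ⇒ open in holdings).
DEDUP (`lean search` / tree grep on every new top-level name: `KPHypothesesThree`, `KuriharaPollackFreeRankOneThree`,
`KuriharaPollackSequenceShape`, `LocalPointsModuleDatum`, `MWTag`, `MWRow`, `mwTable`, …): no match (`KuriharaPollack2007`
is a bib key of the X8 files, unrelated declarations). Reused by name, not re-declared: Literature's `selmerGroup`,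
`localTamagawaNumber`, `SelmerDualData`, `selmerLayer`, `ZpExtension.IsCyclotomic` / `IsTopGenerator`, `IwasawaAlgebra`;
`ClassO6`, `LocIrr` (`Additive/`); `LocalShapeThree`, `cellLevel`, `irrFloor` (`O6/KatoLocalFloor.lean`); KodairaSymbol.

References: R. Pollack, J. Number Theory 110 (2005) 164–177 = arXiv math/0407393, Thm. 1.1, Thm. 2.1, Prop. 2.2, Prop. 2.3,
sequence (3), Thm. 3.1 (pages re-read by the typer, `lit read arxiv:math/0407393` pp. 1–6) [Pollack2005]; M. Kurihara,
Invent. Math. 149 (2002) Thm. 0.1 [Kurihara2002]; S. Kobayashi, Invent. Math. 152 (2003) Thm. (generators of `Ê(ℚ_{n,p})`)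
[Kobayashi2003]; R. Greenberg, LNM 1716 (1999) §3–4 (control) [GreenbergLNM1716]; J. Coates, R. Greenberg, Invent. Math. 124
(1996) §3 Cor. 3.2 [CoatesGreenberg1996]; P. Schneider, Invent. Math. 79/87 (1985/87) (Λ-rank ≥ 1) [Schneider1985];
D. Delbourgo, Compositio Math. 113 (1998) Hyp. (G), p. 30 [Delbourgo1998]; K. Kato, Astérisque 295 (2004) Thm. 12.5,
Conj. 12.10 [Kato2004Asterisque]; M. Hazewinkel, *Formal Groups and Applications* (1978) [Hazewinkel1978].
-/

set_option autoImplicit false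

noncomputable section

open scoped Classical

open WeierstrassCurve Literature.NumberTheory.EllipticCurves
  Literature.NumberTheory.EllipticCurves.Rank1Residual
  Literature.NumberTheory.EllipticCurves.Rank1Residual.Typed
  Summit.BirchSwinnertonDyer.Rank1Residual.Additive

open Literature.NumberTheory.DiophantineGeometry (KodairaSymbol)

namespace Summit.BirchSwinnertonDyer.Rank1Residual.O6

/-! ## §1 The hypotheses (H1)–(H3) of T-O6-G15, by name against the tree's predicates -/

/-- **(H1)–(H3) of T-O6-G15 "Kurihara–Pollack at a wild 3"** (o6-r1 GEN 15 memo §4.1; Pollack 2005 Thm. 1.1's hypotheses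
"`E(ℚ)` finite, `p ∤ Tam(E/ℚ)`, `Ш(E/ℚ)[p] = 0`" transported to the wild additive prime `3`):
(H1) `Sel₃(W/ℚ) = 0` — the `3`-Selmer group of `W/ℚ` (Literature `W.selmerGroup 3 ⊆ H¹(ℚ, W[3])`) is trivial;
(H2) `3 ∤ c_ℓ(W)` for every prime `ℓ ≠ 3` (the `ℤ_ℓ`-minimal-model Tamagawa number of Literature `Tamagawa.lean`) and
`W(ℚ)[3] = 0`; (H3) `W(ℚ₃)[3] = 0` (no `ℚ₃`-rational `3`-torsion; it implies `W(k_{n,𝔭})[3] = 0` for every layer since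
`G_n` is a `3`-group, and replaces Pollack's "`a_p ≢ 1 (mod p)`"). A sub-partition PREDICATE with a body (census-decidable
columns: `selmerDimThree`, the Tamagawa bits `[3 ∣ c_ℓ]`, `NoLocalThreeTorsionAt W 3` of the O5 files are its shadows);
nothing asserted. [cite: Pollack2005, Thm. 1.1 (hypotheses) and Thm. 2.1 (E(ℚ)[p] = 0, p ∤ Tam)] -/
def KPHypothesesThree (W : WeierstrassCurve ℚ) [W.IsElliptic] : Prop :=
  Nat.card (W.selmerGroup 3) = 1 ∧
    (∀ (ℓ : ℕ) [Fact ℓ.Prime], ℓ ≠ 3 → ¬ 3 ∣ (W.baseChange ℚ_[ℓ]).localTamagawaNumber ℤ_[ℓ]) ∧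
    (∀ P : W.toAffine.Point, 3 • P = 0 → P = 0) ∧
    (∀ P : (W.baseChange ℚ_[3]).toAffine.Point, 3 • P = 0 → P = 0)

/-- (H3) alone, for statements that need only the local torsion condition. [folklore] -/
def NoRationalThreeTorsionOverQ3 (W : WeierstrassCurve ℚ) : Prop :=
  ∀ P : (W.baseChange ℚ_[3]).toAffine.Point, 3 • P = 0 → P = 0

/-- `KPHypothesesThree` carries (H3). [folklore] -/
theorem KPHypothesesThree.noRationalThreeTorsionOverQ3 {W : WeierstrassCurve ℚ} [W.IsElliptic]
    (h : KPHypothesesThree W) : NoRationalThreeTorsionOverQ3 W :=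
  h.2.2.2

/-! ## §2 KP-3: `X_∞` is `Λ`-free of rank one (THEOREM-CANDIDATE; the statement handed to provers) -/

/-- **KP-3 `KuriharaPollackFreeRankOneThree` (THEOREM-CANDIDATE, o6-r1 GEN 15 memo §4.1 (KP-3) / §4.2 "verbatim
transports of Greenberg/Pollack"; `@[conjecture]` until a kernel proof; EVIDENCE-labelled).** For `W ∈ O6` satisfying
(H1)–(H3), the Pontryagin dual `X_∞ = X(W/ℚ_∞)` of the `3^∞`-Selmer group over the cyclotomic `ℤ₃`-extension of `ℚ` (the
tree's `SelmerDualData W κ γ`, `κ` cyclotomic, `γ` a topological generator) is a FREE `Λ = ℤ₃⟦T⟧`-module of RANK ONE.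
Printed template (good supersingular `p`): Pollack 2005 Prop. 2.3 — "`rank_Λ X_∞ ≥ 1` by Schneider; `Sel_p(E/ℚ) = 0` gives
`Ê(ℚ_p) ↠ (X_∞)_Γ` by the sequence (3) at `n = 0`, `Ê(ℚ_p) ≅ ℤ_p`, `(X_∞)_Γ` infinite, so the map is an isomorphism
and compact Nakayama gives freeness of rank 1" — resting on Thm. 2.1 (control for `Sel′`, Mazur / Greenberg: "the ordinary
hypothesis is only used in studying the primes over `p`") and Prop. 2.2 (`H¹(ℚ_{∞,p}, E)[p^∞] = 0`, Hazewinkel; "see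
[C-G] for deeply ramified extensions"). TRANSPORT to the wild `3` (memo §4.1–4.2): Prop. 2.2 ↦ KP-1 = Coates–Greenberg
for the deeply ramified `k_{∞,𝔭}` (tree: `CoatesGreenberg1996_H1_formalGroup_trivial`, and n1011-p05's minimal-model
currency `Additive/MinimalModelKernelH1OfDeeplyRamified.lean`); Thm. 2.1 ↦ KP-2 = Greenberg LNM 1716 §3–4 control for
`Sel′` under (H2)+(H3); Schneider's bound ↦ its potentially-supersingular form (n1011-p05's T-CG-SS /
`PotSupersingularNotCotorsionOfDeeplyRamified` is the O5 twin); `Ê(ℚ_p) ≅ ℤ_p` ↦ `W(ℚ₃) ⊗ ℤ₃ ≅ ℤ₃` under (H3). The only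
`W`-specific inputs are (H3) and potential supersingularity (automatic on O6: wild potentially good reduction at `3`).
Why it might fail: only if one of the transported inputs fails at an additive prime — the purpose of handing it to a
prover; it is NOT a census statement. Consequence (memo §4.1): choosing `X_∞ ≅ Λ` turns the dual of (KP-2) into the
finite-level sequence `M_n —F_n→ Λ_n → Sel_{3^∞}(W/k_n)^∨ → 0` (`KuriharaPollackSequenceShape`).
[evidence: none numeric — structural; calibration of the template: C-O6-MW (memo §4.3b) reads g = 1, M ≅ Λ_n FREE, H¹ = 0 on the good ORDINARY 11a1 and Kobayashi's two generators (7,2) on the good supersingular 17a1, as Pollack §2–3 predict]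
[cite: Pollack2005, Prop. 2.3 with Thm. 2.1 and Prop. 2.2 (J. Number Theory 110, pp. 167–169)] [cite: GreenbergLNM1716, §3–4 (control theorems)]
[cite: CoatesGreenberg1996, §3 Cor. 3.2] [cite: Schneider1985, as quoted in Pollack2005 Prop. 2.3 and GreenbergLNM1716 §1 Thm. 1.7 (pp. 61–62)] -/
@[conjecture] def KuriharaPollackFreeRankOneThree : Prop :=
  ∀ (W : WeierstrassCurve ℚ) [W.IsElliptic] [W.IsGloballyMinimal],
    ClassO6 W 3 → KPHypothesesThree W →
      ∀ {κ : ZpExtension ℚ 3} {γ : Field.absoluteGaloisGroup ℚ} (D : SelmerDualData W κ γ),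
        κ.IsCyclotomic → κ.IsTopGenerator γ →
          Module.Free (IwasawaAlgebra 3) D.X ∧ Module.finrank (IwasawaAlgebra 3) D.X = 1

/-- Bookkeeping (PROVED): under KP-3 the Iwasawa module is NOT torsion (a free module of positive rank over the domain
`Λ` has a non-torsion element) — the O6 counterpart, CONDITIONAL on the node, of n1011-p05's unconditional O5 theorem
`ClassO5.not_isTorsion_of_deeplyRamifiedTrace`; recorded so that consumers of `¬ D.IsTorsion` on O6 can cite one name.
[folklore] -/
theorem not_isTorsion_of_kuriharaPollackFreeRankOne (h : KuriharaPollackFreeRankOneThree)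
    (W : WeierstrassCurve ℚ) [W.IsElliptic] [W.IsGloballyMinimal] (hO : ClassO6 W 3) (hKP : KPHypothesesThree W)
    {κ : ZpExtension ℚ 3} {γ : Field.absoluteGaloisGroup ℚ} (D : SelmerDualData W κ γ) (hκ : κ.IsCyclotomic)
    (hγ : κ.IsTopGenerator γ) : ¬ D.IsTorsion := by
  obtain ⟨hfree, hrank⟩ := h W hO hKP D hκ hγ
  intro htors
  -- a free module of finrank 1 over the domain Λ = ℤ₃⟦T⟧ is non-trivial and torsion-free
  haveI := hfree
  haveI : Nontrivial D.X := Module.nontrivial_of_finrank_eq_succ hrank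
  obtain ⟨x, hx⟩ := exists_ne (0 : D.X)
  have hx' : ∃ a : nonZeroDivisors (IwasawaAlgebra 3), a • x = 0 :=
    (htors : Module.IsTorsion (IwasawaAlgebra 3) D.X) (x := x)
  obtain ⟨⟨a, ha⟩, hax⟩ := hx'
  have hax' : a • x = 0 := by simpa [Submonoid.mk_smul] using hax
  rcases smul_eq_zero.mp hax' with h0 | h0
  · exact nonZeroDivisors.ne_zero ha h0
  · exact hx h0

/-! ## §3 The finite-level Kurihara–Pollack sequence as a hypothesis SCHEMA over `selmerLayer` -/

/-- **KP-3(n) / KP-4 shape `KuriharaPollackSequenceShape` (hypothesis SCHEMA, nothing asserted).** For the cyclotomic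
`ℤ₃`-extension `κ` of `ℚ` and an index function `idx : ℕ → ℕ`: for every layer `n`, the `3^∞`-Selmer group of `W` over
`k_n` (the tree's `W.selmerLayer κ n ⊆ H¹(k_n, W[3^∞])`) is FINITE of order `3^{idx n}`. In Pollack's sequence (3)
`M_n —F_n→ Λ_n → Sel_p(E/ℚ_n)^∨ → 0` (dual of the controlled `Sel′`-sequence, with `X_∞ ≅ Λ` by KP-3), `idx n =
length(Λ_n / F_n(M_n))`; under (H1)–(H3) `W(k_n)` is finite (Pollack Thm. 1.1 (1) transported) so `idx n = e_n :=
ord₃ #Ш(W/k_n)[3^∞]`; and under KMC₃ (KP-4, Kato Thm. 12.5 + Conj. 12.10 — the slot-1 interface of `O6/O6Targets.lean`,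
never a fact) `e_n = ord₃[Λ_n² : M_n + Λ_n z_n] = ord₃[exp* H¹(k_{n,𝔭}, T) : Λ_n·exp*(z_n)]`, a MODULE INDEX of the
`L`-value vector in the local lattice — the `χ`-by-`χ` floor deficits of `O6/KatoLocalFloor*.lean` being its gluing term
(memo §4.1 (KP-4)). The schema is what a prover's KP-2/KP-3 transport OUTPUTS; it is consumed, e.g., as the `e` of
`ThreeBSDTowerBookkeeping` (`O6/ShaGrowthDictionary.lean`). [cite: Pollack2005, §2 sequence (3) and Thm. 1.1 (1)–(2)]
[cite: Kato2004Asterisque, Thm. 12.5 and Conj. 12.10] -/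
def KuriharaPollackSequenceShape (W : WeierstrassCurve ℚ) (κ : ZpExtension ℚ 3) (idx : ℕ → ℕ) : Prop :=
  ∀ n : ℕ, Nat.card (W.selmerLayer κ n) = 3 ^ idx n

/-! ## §4 The local crux (L) = R-O6-LOC: interface `LocalPointsModuleDatum` and the C-O6-MW table (EVIDENCE) -/

/-- **D-O6-MW (interface): the `ℤ₃[G_n]`-MODULE INVARIANTS of the local points along the tower** (o6-r1 GEN 15 memo
§4.1 (L), §4.3, §4.5; instrument C-O6-MW `gen15/mw/c_o6_mw.py`). For `W ∈ O6` and `n ≥ 1`, with `M := log_{ω_ℚ}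
Ê_min(𝔪_{k_n,𝔭}) ⊂ k_{n,𝔭}` — CANONICAL and `G_n`-STABLE (memo §4.5(a)), of index `3^{1+ord₃ c_n}` in `W(k_{n,𝔭}) ⊗ ℤ₃`
under (H3): `gens n = g_n = dim_{𝔽₃} M/(3, σ−1)M` (minimal number of `Λ_n`-generators); `jordan n` = the Jordan type of
`σ − 1` on `M/3M` (block sizes, a partition of `3^n = dim_{𝔽₃} M/3M`); `h1 n` = the elementary-divisor exponents of
`H¹(G_n, Ê_min(𝔪_{k_n,𝔭}))` (= the torsion of the coinvariants `M/(σ−1)M`, memo §4.5(b): "'coinv' IS COHOMOLOGY"; these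
finite-level groups are exactly the KP-2 error terms whose limit Coates–Greenberg kills); `atop n` (depth of `e_n·M` in
`M ∩ V_n^{new}`), `jmin n`, `jcum n` (gen-14 J-invariants), `ostab n = ord₃[M + πM : M]` (`0` iff `M` is literally a
fractional ideal of `k_{n,𝔭}`). The structure only NAMES the datum; existence/uniqueness on O6 is the construction shape
`LocalPointsModuleDatum.RealisedShape`; the linear-algebra identities every realised datum satisfies are the predicate
`IsConsistent` (expected to be entailed by `realM`). Mathlib has formal groups of elliptic curves over neither `ℚ₃` nor
`k_{n,𝔭}` as `ℤ₃[G_n]`-lattices, hence an interface. This IS the object a structure theorem (L) must describe: "minimal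
generators `g_n`, trace relations `M_n → M_{n−1}`, Jordan type of `σ−1` on `M_n/3`, gluing depths — the analogue of
Kobayashi's theorem (Pollack Thm. 3.1: two generators `c_n, c_{n−1}`, `Tr c_n = a_p c_{n−1} − c_{n−2}`) for the wild
potentially-supersingular formal group" (memo §4.1 (L)). [cite: Pollack2005, Thm. 3.1 (Kobayashi's generators)]
[cite: Kobayashi2003, §8 (Prop. 8.12), as quoted in Pollack2005 Thm. 3.1] -/
structure LocalPointsModuleDatum (W : WeierstrassCurve ℚ) where
  /-- `g_n`: minimal number of `ℤ₃[G_n]`-generators of `M = log_{ω_ℚ} Ê_min(𝔪_{k_n,𝔭})`. -/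
  gens : ℕ → ℕ
  /-- Jordan type (block sizes) of `σ − 1` on `M/3M`. -/
  jordan : ℕ → List ℕ
  /-- exponents `aᵢ` with `H¹(G_n, Ê_min(𝔪_{k_n,𝔭})) ≅ ⊕ ℤ/3^{aᵢ}`. -/
  h1 : ℕ → List ℕ
  /-- `a_top`: depth of `e_n·M` in `M ∩ V_n^{new}`. -/
  atop : ℕ → ℕ
  /-- `J_min` (gen-14 J-invariant). -/
  jmin : ℕ → ℕ
  /-- `J_cum` (gen-14 J-invariant). -/
  jcum : ℕ → ℕ
  /-- `ostab = ord₃[M + πM : M]` (`𝒪`-stability defect). -/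
  ostab : ℕ → ℕ

namespace LocalPointsModuleDatum

variable {W : WeierstrassCurve ℚ}

/-- **Structural identities of a realised datum** (memo §4.5(b), linear algebra of a `G_n`-stable lattice `M` with
`M ⊗ ℚ ≅ ℚ₃[G_n]`, `Λ_n` local with maximal ideal `(3, σ−1)`): at every level `n ≥ 1`, the Jordan blocks of `σ − 1` on
`M/3M` sum to `dim_{𝔽₃} M/3M = 3^n`; their NUMBER `= dim ker(σ−1 | M/3M) = dim M/(3, σ−1)M = g_n`; and `g_n = 1 + #{cyclic
factors of H¹(G_n, ·)}` (the coinvariants `M/(σ−1)M` have `ℤ₃`-rank `1` and torsion `H¹`). A predicate; on the table of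
record it is PROVED row by row (`mwTable_consistent`). [folklore] -/
def IsConsistent (M : LocalPointsModuleDatum W) : Prop :=
  ∀ n, 1 ≤ n → (M.jordan n).sum = 3 ^ n ∧ (M.jordan n).length = M.gens n ∧ M.gens n = 1 + (M.h1 n).length

/-- `H¹(G_n, Ê_min(𝔪))` is ELEMENTARY (killed by `3`) at level `n` iff all exponents are `1` — the property every
fractional IDEAL of `k_n` has (`(ℤ/3)^{g−1}`) and the rows 189d1 (`ℤ/9`) / 459h1 (`ℤ/3 ⊕ ℤ/9`) violate at `n = 3`
(memo §4.3b (R5), the argument excluding H-IDEAL on (3,II*)/(3,IV*)). [folklore] -/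
def H1IsElementaryAt (M : LocalPointsModuleDatum W) (n : ℕ) : Prop := ∀ a ∈ M.h1 n, a = 1

end LocalPointsModuleDatum

/-- **CONSTRUCTION shape for D-O6-MW** (hypothesis schema over the interface predicate `realM`, not a conjecture node):
on O6 the module datum exists, is unique and consistent. Nothing asserted. [folklore] -/
def LocalPointsModuleDatum.RealisedShape
    (realM : ∀ (W : WeierstrassCurve ℚ) [W.IsElliptic] [W.IsGloballyMinimal], LocalPointsModuleDatum W → Prop) : Prop :=
  ∀ (W : WeierstrassCurve ℚ) [W.IsElliptic] [W.IsGloballyMinimal],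
    ClassO6 W 3 → (∃! M : LocalPointsModuleDatum W, realM W M) ∧
      ∀ M : LocalPointsModuleDatum W, realM W M → M.IsConsistent

/-! ### The C-O6-MW table of record (memo §4.3b, 2026-08-22T00:30Z; EVIDENCE; `decide`d consistency) -/

/-- Class column of the C-O6-MW table: the six shapes of `W[3]|G_{ℚ₃}` (as `LocalShapeThree`), the `j = 0` rows (`CM`),
and the calibration rows (good ORDinary 11a1, good SuperSingular 17a1 / CM 32a1). [folklore] -/
inductive MWTag
  | ET1 | ETM | ORD1 | ORDM | SPLIT | IRR | CM | GOODORD | GOODSS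
  deriving DecidableEq, Repr

/-- One level-row of the C-O6-MW table: Cremona label, `f = v₃(N)` (`0` for the calibration rows), Kodaira symbol at `3`,
class tag, level `n`, and the invariants `g`, Jordan blocks, `H¹` exponents, `a_top`, `J_min`, `J_cum` (`none` where the
memo prints no value — the calibration rows; `ostab` is recorded in the docstring of `mwTable` for the v1.1 rows only).
[folklore] -/
structure MWRow where
  /-- Cremona label. -/
  label : String
  /-- `v₃(N)` (`0` = calibration row, good reduction at `3`). -/
  f : ℕ
  /-- Kodaira symbol at `3` over `ℚ`. -/
  kod : KodairaSymbol
  /-- class tag. -/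
  tag : MWTag
  /-- level `n` (`|G_n| = 3^n`). -/
  n : ℕ
  /-- `g_n`. -/
  gens : ℕ
  /-- Jordan type of `σ − 1` on `M/3M`. -/
  jordan : List ℕ
  /-- exponents of `H¹(G_n, Ê_min(𝔪))`. -/
  h1 : List ℕ
  /-- `a_top` (`none` = not printed). -/
  atop : Option ℕ
  /-- `J_min` (`none` = not printed). -/
  jmin : Option ℕ
  /-- `J_cum` (`none` = not printed). -/
  jcum : Option ℕ
  deriving DecidableEq, Repr

/-- **The C-O6-MW table of o6-r1 GEN 15 (memo §4.3b, state 2026-08-22T00:30Z: kit j143548 ✓ v1.1 on the six (3,II)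
representatives with the ideal reference `n ≤ 3`; j143088 / j143437 / j143439 partial; j143554 ideals `n ≤ 4` running).
EVIDENCE — census values transcribed verbatim, one row per (curve, level); `J` written `J_min/J_cum`; `ostab` (v1.1 rows):
17a1 `1, 3` (n = 2, 3), (3,II) ETM/SPLIT/CM `1, 5`, (3,II) IRR `0, 2` ("`M₂ = 𝔪_{k_2}^{−1}` LITERALLY").** READINGS
(memo, EVIDENCE, not typed as laws): (R1) invariants CONSTANT within every (τ, class) group with ≥ 2 curves (297b1 = 297d1
= 2403a1 = 432b1; 702b1 = 1080g1; 3888k1 = 3888l1), independent of `c₃`, rank, CM; (R2) at `τ = (3,II)` the module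
SEPARATES IRR `{(6,2,1); (20,6,1), a_top 2, J 7/9}` from ETM = SPLIT = CM `{(7,1,1); (22,4,1), a_top 4, J 5/6}` at `n = 2`
and `3` and does NOT see `j = 0` — as memo §4.1 (L) predicts; (R3) the profile is NOT a function of the class alone across
`τ` ((5,II) ORD1 carries the (3,II)-IRR profile); (R4) `g_n = 3` generators on every `f ∈ {3 (II), 5}` row at `n = 2, 3`
(Kobayashi: 2; `𝒪_{k_3}`: 4); (R5) `H¹ = (ℤ/3)²` on the `g = 3` rows but `ℤ/9` (189d1) and `ℤ/3 ⊕ ℤ/9` (459h1) at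
`n = 3` — non-elementary, unlike any ideal of `k_n`; (5,IV) ET1 1701g1 has `vL = 2 − d_n`: a 3-torsion point in
`Ê_min(𝔪)`, (H3) fails visibly. H-IDEAL VERDICT (memo §4.5(d), j143548): "`M_n ≅ 𝔪_{k_n}^j`" is TRUE literally at
`n = 2` for (3,II) IRR and FALSE at `n = 3` for every (3,II) class (no ideal class of `k_3` has `(g, blocks, H¹) =
(3, (22,4,1), (ℤ/3)²)` or `(3, (20,6,1), (ℤ/3)²)`; `ostab > 0`) ⇒ R-O6-LOC is NOT classical ideal theory (Lettl 1998 /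
Byott 1997); nearest formalism = Bondarko's associated additive Galois modules. Calibration: 11a1 (good ordinary) `g = 1`,
`M ≅ Λ_n` free, `H¹ = 0`; 17a1 (good supersingular, = CM 32a1) `g = 2`, `(7,2)` — Kobayashi's two generators.
[evidence: census cell O6, o6-r1 GEN 15 C-O6-MW v1/v1.1: kit j143027 (smoke, calibration), j143548 ✓, j143088 / j143437 / j143439 (partial at 00:30Z), j143554 (ideal reference n ≤ 4); script gen15/mw/c_o6_mw.py, tabulator gen15/mw/mw_table.py, input mw_in.txt (35 island representatives + 5 calibration curves)]
[cite: Pollack2005, Thm. 3.1 (the two-generator calibration)] -/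
def mwTable : List MWRow :=
  [ -- calibration rows (good reduction at 3)
    ⟨"11a1", 0, .I 0, .GOODORD, 2, 1, [9], [], none, none, none⟩,
    ⟨"17a1", 0, .I 0, .GOODSS, 2, 2, [7, 2], [1], none, none, none⟩,
    ⟨"17a1", 0, .I 0, .GOODSS, 3, 2, [21, 6], [1], some 3, some 6, some 8⟩,
    ⟨"32a1", 0, .I 0, .GOODSS, 2, 2, [7, 2], [1], none, none, none⟩,
    -- (3,II) reducible classes: ETM 297b1, 297d1; SPLIT 2403a1; CM 432b1 — identical profiles
    ⟨"297b1", 3, .II, .ETM, 2, 3, [7, 1, 1], [1, 1], some 1, some 1, some 1⟩,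
    ⟨"297b1", 3, .II, .ETM, 3, 3, [22, 4, 1], [1, 1], some 4, some 5, some 6⟩,
    ⟨"297d1", 3, .II, .ETM, 2, 3, [7, 1, 1], [1, 1], some 1, some 1, some 1⟩,
    ⟨"297d1", 3, .II, .ETM, 3, 3, [22, 4, 1], [1, 1], some 4, some 5, some 6⟩,
    ⟨"2403a1", 3, .II, .SPLIT, 2, 3, [7, 1, 1], [1, 1], some 1, some 1, some 1⟩,
    ⟨"2403a1", 3, .II, .SPLIT, 3, 3, [22, 4, 1], [1, 1], some 4, some 5, some 6⟩,
    ⟨"432b1", 3, .II, .CM, 2, 3, [7, 1, 1], [1, 1], some 1, some 1, some 1⟩,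
    ⟨"432b1", 3, .II, .CM, 3, 3, [22, 4, 1], [1, 1], some 4, some 5, some 6⟩,
    -- (3,II) IRR 702b1 (rank 1), 1080g1 — identical
    ⟨"702b1", 3, .II, .IRR, 2, 3, [6, 2, 1], [1, 1], some 0, some 2, some 2⟩,
    ⟨"702b1", 3, .II, .IRR, 3, 3, [20, 6, 1], [1, 1], some 2, some 7, some 9⟩,
    ⟨"1080g1", 3, .II, .IRR, 2, 3, [6, 2, 1], [1, 1], some 0, some 2, some 2⟩,
    ⟨"1080g1", 3, .II, .IRR, 3, 3, [20, 6, 1], [1, 1], some 2, some 7, some 9⟩,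
    -- (3,IV*) IRR 459h1 (c₃ = 3): H¹ = ℤ/3 ⊕ ℤ/9 at n = 3
    ⟨"459h1", 3, .IVstar, .IRR, 2, 2, [7, 2], [1], some 1, some 2, some 2⟩,
    ⟨"459h1", 3, .IVstar, .IRR, 3, 3, [20, 6, 1], [1, 2], some 2, some 6, some 8⟩,
    -- (3,II*) ORD1 189d1: H¹ = ℤ/9 at n = 3; ORDM 135b1
    ⟨"189d1", 3, .IIstar, .ORD1, 2, 2, [7, 2], [1], some 1, some 1, some 1⟩,
    ⟨"189d1", 3, .IIstar, .ORD1, 3, 2, [24, 3], [2], some 6, some 3, some 4⟩,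
    ⟨"135b1", 3, .IIstar, .ORDM, 2, 2, [8, 1], [1], some 2, some 0, some 0⟩,
    -- (4,II*) ORD1 3483c1
    ⟨"3483c1", 4, .IIstar, .ORD1, 2, 2, [6, 3], [1], some 0, some 2, some 2⟩,
    -- (5,II) ORD1 1701c1 (= the (3,II)-IRR profile); ORDM 1215i1
    ⟨"1701c1", 5, .II, .ORD1, 2, 3, [6, 2, 1], [1, 1], some 0, some 2, some 2⟩,
    ⟨"1701c1", 5, .II, .ORD1, 3, 3, [20, 6, 1], [1, 1], some 2, some 6, some 8⟩,
    ⟨"1215i1", 5, .II, .ORDM, 2, 3, [7, 1, 1], [1, 1], some 1, some 1, some 1⟩,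
    ⟨"1215i1", 5, .II, .ORDM, 3, 3, [21, 5, 1], [1, 1], some 3, some 5, some 6⟩,
    -- (5,IV) ET1 1701g1 (vL = 2 − d_n: (H3) fails); ETM 1215b1 (j ≠ 0) at n = 2; CM (j = 0) 3888k1 = 3888l1
    ⟨"1701g1", 5, .IV, .ET1, 2, 3, [7, 1, 1], [1, 1], some 1, some 2, some 2⟩,
    ⟨"1701g1", 5, .IV, .ET1, 3, 3, [23, 3, 1], [1, 1], some 5, some 3, some 5⟩,
    ⟨"1215b1", 5, .IV, .ETM, 2, 3, [6, 2, 1], [1, 1], some 0, some 2, some 2⟩,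
    ⟨"3888k1", 5, .IV, .CM, 2, 3, [6, 2, 1], [1, 1], some 0, some 2, some 2⟩,
    ⟨"3888k1", 5, .IV, .CM, 3, 3, [22, 3, 2], [1, 1], some 4, some 4, some 6⟩,
    ⟨"3888l1", 5, .IV, .CM, 2, 3, [6, 2, 1], [1, 1], some 0, some 2, some 2⟩,
    ⟨"3888l1", 5, .IV, .CM, 3, 3, [22, 3, 2], [1, 1], some 4, some 4, some 6⟩ ]

/-- **The table satisfies the structural identities on every row** (PROVED, `decide`): Jordan blocks sum to `3^n`, their
number is `g_n`, and `g_n = 1 + #(cyclic factors of H¹)` — the instrument's `g`, block, and "coinv" columns are mutually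
consistent exactly as the cohomological reading of memo §4.5(b) requires (33 / 33 level-rows). [folklore] -/
theorem mwTable_consistent :
    ∀ r ∈ mwTable, r.jordan.sum = 3 ^ r.n ∧ r.jordan.length = r.gens ∧ r.gens = 1 + r.h1.length := by
  decide

/-- **(R2) at `τ = (3,II)` in the table (PROVED on the rows, `decide`): every IRR row and every reducible (ETM / SPLIT / CM)
row of conductor exponent `3`, Kodaira II, have DIFFERENT Jordan types at the same level** — the instrument separates
`W[3]|G_{ℚ₃}` irreducible from reducible at fixed type and does not see `j = 0` (432b1 = 297b1), as (L) predicts.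
EVIDENCE about these rows only; no law is asserted. [folklore] -/
theorem mwTable_threeII_irr_ne_reducible :
    ∀ r ∈ mwTable, ∀ r' ∈ mwTable, r.f = 3 → r.kod = .II → r'.f = 3 → r'.kod = .II → r.n = r'.n →
      r.tag = .IRR → (r'.tag = .ETM ∨ r'.tag = .SPLIT ∨ r'.tag = .CM) → r.jordan ≠ r'.jordan := by
  decide

/-- **(R5) in the table (PROVED on the rows, `decide`): the `n = 3` rows of 189d1 and 459h1 have NON-elementary `H¹`**
(`ℤ/9`, `ℤ/3 ⊕ ℤ/9`) — the datum excluding H-IDEAL on (3,II*)/(3,IV*), since every fractional ideal of `k_n` has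
elementary `H¹(G_n, ·)`. EVIDENCE about these rows only. [folklore] -/
theorem mwTable_nonelementary_rows :
    ∃ r ∈ mwTable, r.label = "189d1" ∧ r.n = 3 ∧ r.h1 = [2] ∧
      ∃ r' ∈ mwTable, r'.label = "459h1" ∧ r'.n = 3 ∧ r'.h1 = [1, 2] := by
  decide

/-- A datum AGREES with the table on a labelled curve when its invariants at the table's levels are the table's (the shape
in which a `realM`-datum of, e.g., 702b1 would be confronted with the census rows; nothing asserted). [folklore] -/
def LocalPointsModuleDatum.AgreesWithTable {W : WeierstrassCurve ℚ} (M : LocalPointsModuleDatum W) (label : String) :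
    Prop :=
  ∀ r ∈ mwTable, r.label = label →
    M.gens r.n = r.gens ∧ M.jordan r.n = r.jordan ∧ M.h1 r.n = r.h1 ∧
      (∀ a, r.atop = some a → M.atop r.n = a) ∧ (∀ a, r.jmin = some a → M.jmin r.n = a) ∧
      (∀ a, r.jcum = some a → M.jcum r.n = a)

end Summit.BirchSwinnertonDyer.Rank1Residual.O6

end
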